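import Literature.Algebra.EuclideanLattices.SmoothingUniformity
import HarnessLib

/-!
# A continuous Gaussian rounded to the lattice by a discrete Gaussian is a discrete Gaussian (Peikert 2010, Thm 3.1 special case = BLPRS 2013, Lemma 2.10)

Topic `Algebra/EuclideanLattices` (family `pqc`). Bottom layer of the decomposition of
Brakerski–Langlois–Peikert–Regev–Stehlé 2013 (`blprs_gapSVP_sqrt_dim_to_lwe_classical`, pqc.S21):
their Lemma 2.10, the special case of Peikert's convolution theorem used in the normal-form
reduction (BLPRS Lemma 2.12) and in the Gaussian randomised rounding of the modulus-switching map
(BLPRS Lemma 3.5). Everything here is PROVED; theorems only, in the density style of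
`GaussianCosetConvolution.lean` (Regev's Claim 3.9) and `SmoothingUniformity.lean` (imports only the
latter).

## Results (`L` a full-rank lattice in dimension `n`, `0 < r, s`, `t = √(r² + s²)`, `s ≥ η_ε(L)`, `0 < ε ≤ 1/2`)

Sample `x ← D_r` (density `ρ_r/rⁿ`) and then `y ← D_{L-x,s}`; the lattice point `x + y = λ ∈ L`
is drawn with probability `D_{L,s,x}(λ) = ρ_s(λ - x)/ρ_s(L - x)` (`discreteGaussian L s x λ`), so
its law is `P(λ) = ∫ ρ_r(x)/rⁿ · D_{L,s,x}(λ) dx`. Write `G(λ) = ρ_t(λ) vol(L)/tⁿ`.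

* `gaussianFunction_mul_gaussianFunction_sub'` — the product identity
  `ρ_r(x) ρ_s(λ - x) = ρ_t(λ) ρ_{rs/t}(x - (r²/t²) λ)`.
* `tsum_gaussianFunction_sub_mem_Icc` — Regev's Claim 3.8 in two-sided series form:
  `ρ_{p,c}(L) ∈ [1-ε, 1+ε] · pⁿ/vol(L)` for `p ≥ η_ε(L)`.
* `Peikert2010.integral_mul_discreteGaussian_mem_Icc` — `P(λ) ∈ [G(λ)/(1+ε), G(λ)/(1-ε)]`
  (`ρ_s(L - x) ∈ [1±ε] sⁿ/vol` uniformly in `x`, and `∫ ρ_r(x)ρ_s(λ - x) dx = ρ_t(λ) (rs/t)ⁿ`).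
* `Peikert2010.toReal_discreteGaussian_mem_Icc` — `D_{L,t}(λ) ∈ [G(λ)/(1+ε), G(λ)/(1-ε)]`.
* `Peikert2010.abs_integral_mul_discreteGaussian_sub_le` — **pointwise**:
  `|P(λ) - D_{L,t}(λ)| ≤ 4ε · D_{L,t}(λ)` for every `λ ∈ L`.
* `Peikert2010.tsum_abs_integral_mul_discreteGaussian_sub_le` — summed: `∑_λ |P(λ) - D_{L,t}(λ)| ≤ 4ε`,
  so the statistical distance `½ ∑_λ |…|` is `≤ 2ε`; in particular the printed
  **BLPRS 2013, Lemma 2.10** bound `≤ 8ε` (`Peikert2010.half_tsum_abs_sub_le`).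

## References

* C. Peikert, *An efficient and parallel Gaussian sampler for lattices*, CRYPTO 2010, Thm 3.1.
* Z. Brakerski, A. Langlois, C. Peikert, O. Regev, D. Stehlé, *Classical hardness of learning with
  errors*, STOC 2013, Lemma 2.10 (arXiv:1306.0281).
* O. Regev, *On lattices, learning with errors, random linear codes, and cryptography*, J. ACM 56
  (2009), Claim 3.8 (the input estimate).
-/

noncomputable section

open MeasureTheory Module
open scoped Real ENNReal InnerProductSpace

namespace Literature.Algebra.EuclideanLattices

variable {E : Type*} [NormedAddCommGroup E] [InnerProductSpace ℝ E]

/-- The product identity with the roles needed for rounding: for `0 < r, s`, `t = √(r² + s²)`,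
`ρ_r(x) ρ_s(λ - x) = ρ_t(λ) ρ_{rs/t}(x - (r²/t²) λ)` (completing the square; the case `u = 0` of
`gaussianFunction_sub_neg_mul_gaussianFunction_sub_add` of `GaussianCosetConvolution.lean`, proved
directly so that this file does not depend on it). [folklore] -/
theorem gaussianFunction_mul_gaussianFunction_sub' {r s : ℝ} (hr : 0 < r) (hs : 0 < s) (x lam : E) :
    gaussianFunction r x * gaussianFunction s (lam - x) =
      gaussianFunction (Real.sqrt (r ^ 2 + s ^ 2)) lam *
        gaussianFunction (r * s / Real.sqrt (r ^ 2 + s ^ 2))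
          (x - (r ^ 2 / Real.sqrt (r ^ 2 + s ^ 2) ^ 2) • lam) := by
  set t := Real.sqrt (r ^ 2 + s ^ 2) with ht
  have htsq : t ^ 2 = r ^ 2 + s ^ 2 := Real.sq_sqrt (by positivity)
  simp only [gaussianFunction, ← Real.exp_add]
  congr 1
  have h1 : ‖lam - x‖ ^ 2 = ‖lam‖ ^ 2 - 2 * ⟪lam, x⟫_ℝ + ‖x‖ ^ 2 := norm_sub_sq_real lam x
  have h2 : ‖x - (r ^ 2 / t ^ 2) • lam‖ ^ 2 =
      ‖x‖ ^ 2 - 2 * ((r ^ 2 / t ^ 2) * ⟪lam, x⟫_ℝ) + (r ^ 2 / t ^ 2) ^ 2 * ‖lam‖ ^ 2 := by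
    rw [norm_sub_sq_real, inner_smul_right, real_inner_comm, norm_smul, mul_pow, Real.norm_eq_abs,
      sq_abs]
  rw [h1, h2, show (r * s / t) ^ 2 = r ^ 2 * s ^ 2 / t ^ 2 by rw [div_pow, mul_pow], htsq]
  have hr2 : r ^ 2 ≠ 0 := by positivity
  have hs2 : s ^ 2 ≠ 0 := by positivity
  have hrs : r ^ 2 + s ^ 2 ≠ 0 := by positivity
  field_simp
  ring

/-- Bookkeeping: if `G/(1+ε) ≤ I ≤ G/(1-ε)` and `G/(1+ε) ≤ D ≤ G/(1-ε)` with `0 < ε ≤ 1/2` and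
`0 ≤ G`, then `|I - D| ≤ 4ε D` (indeed `I ≤ (1+ε)/(1-ε) D ≤ (1+4ε) D` and
`I ≥ (1-ε)/(1+ε) D ≥ (1-2ε) D`). [folklore] -/
theorem abs_sub_le_four_mul_of_div_le {I D G ε : ℝ} (hε : 0 < ε) (hε' : ε ≤ 1 / 2) (hG : 0 ≤ G)
    (hI1 : G / (1 + ε) ≤ I) (hI2 : I ≤ G / (1 - ε)) (hD1 : G / (1 + ε) ≤ D) (hD2 : D ≤ G / (1 - ε)) :
    |I - D| ≤ 4 * ε * D := by
  have h1e : 0 < 1 - ε := by linarith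
  have h2e : 0 < 1 + ε := by linarith
  have hGD : G ≤ (1 + ε) * D := by rwa [div_le_iff₀' h2e] at hD1
  have hGD' : (1 - ε) * D ≤ G := by rwa [le_div_iff₀' h1e] at hD2
  have hGI : G ≤ (1 + ε) * I := by rwa [div_le_iff₀' h2e] at hI1
  have hGI' : (1 - ε) * I ≤ G := by rwa [le_div_iff₀' h1e] at hI2
  have hD0 : 0 ≤ D := le_trans (div_nonneg hG h2e.le) hD1
  rw [abs_le]
  constructor
  · nlinarith
  · nlinarith

variable [FiniteDimensional ℝ E] [MeasurableSpace E] [BorelSpace E]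
variable (L : Submodule ℤ E) [DiscreteTopology L] [IsZLattice ℝ L]

/-- **Regev 2009, Claim 3.8, two-sided series form**: for `0 < ε`, `0 < p` with `η_ε(L) ≤ p` and every
centre `c`, `(1-ε) pⁿ/vol(L) ≤ ∑_{y ∈ L} ρ_p(y - c) ≤ (1+ε) pⁿ/vol(L)` (unfolding of the tree's
`abs_gaussianMass_div_sub_one_le_holds`). [cite: RegevLWE2009, Claim 3.8] -/
theorem tsum_gaussianFunction_sub_mem_Icc {ε p : ℝ} (hε : 0 < ε) (hp : 0 < p)
    (hηp : smoothingParameter L ε ≤ p) (c : E) :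
    (1 - ε) * (p ^ finrank ℝ E / ZLattice.covolume L) ≤ ∑' y : L, gaussianFunction p ((y : E) - c) ∧
      ∑' y : L, gaussianFunction p ((y : E) - c) ≤ (1 + ε) * (p ^ finrank ℝ E / ZLattice.covolume L) := by
  have h := abs_gaussianMass_div_sub_one_le_holds L hε hp hηp c
  rw [gaussianMass_coe_eq_ofReal_tsum L hp.ne' c,
    ENNReal.toReal_ofReal (tsum_nonneg fun _ => (gaussianFunction_pos _ _).le)] at h
  have hK : 0 < p ^ finrank ℝ E / ZLattice.covolume L :=
    div_pos (pow_pos hp _) (ZLattice.covolume_pos L volume)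
  obtain ⟨hl, hu⟩ := abs_le.1 h
  constructor
  · have : 1 - ε ≤ (∑' y : L, gaussianFunction p ((y : E) - c)) / (p ^ finrank ℝ E / ZLattice.covolume L) := by
      linarith
    rwa [le_div_iff₀ hK] at this
  · have : (∑' y : L, gaussianFunction p ((y : E) - c)) / (p ^ finrank ℝ E / ZLattice.covolume L) ≤ 1 + ε := by
      linarith
    rwa [div_le_iff₀ hK] at this

omit [MeasurableSpace E] [BorelSpace E] [IsZLattice ℝ L] in
/-- The rounding weight as a function of the continuous sample: for `0 < s` and `λ ∈ L`,
`D_{L,s,x}(λ) = ρ_s(λ - x) / ∑_{y ∈ L} ρ_s(y - x)`. [cite: MicciancioRegev2007, §2] -/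
theorem toReal_discreteGaussian_apply_eq_div {s : ℝ} (hs : 0 < s) (x : E) (lam : L) :
    (discreteGaussian L s x lam).toReal =
      gaussianFunction s ((lam : E) - x) / ∑' y : L, gaussianFunction s ((y : E) - x) := by
  rw [discreteGaussian_apply L hs x lam, ENNReal.toReal_mul,
    ENNReal.toReal_ofReal (gaussianFunction_pos _ _).le, ENNReal.toReal_inv,
    gaussianMass_coe_eq_ofReal_tsum L hs.ne' x,
    ENNReal.toReal_ofReal (tsum_nonneg fun _ => (gaussianFunction_pos _ _).le), div_eq_mul_inv]

/-- Measurability in `x` of the rounding weight `x ↦ D_{L,s,x}(λ)` (continuous numerator, countable sum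
of continuous functions in the denominator). [folklore] -/
theorem measurable_toReal_discreteGaussian_apply {s : ℝ} (hs : 0 < s) (lam : L) :
    Measurable fun x : E => (discreteGaussian L s x lam).toReal := by
  have h : (fun x : E => (discreteGaussian L s x lam).toReal) = fun x : E =>
      gaussianFunction s ((lam : E) - x) / ∑' y : L, gaussianFunction s ((y : E) - x) :=
    funext fun x => toReal_discreteGaussian_apply_eq_div L hs x lam
  rw [h]
  refine Measurable.div (Continuous.measurable ?_) (Measurable.tsum fun y => Continuous.measurable ?_)
  · unfold gaussianFunction; fun_prop
  · unfold gaussianFunction; fun_prop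

/-- **The rounding law is squeezed** (Peikert 2010, proof of Thm 3.1, in the special case of BLPRS
Lemma 2.10): for `0 < ε`, `0 < r, s`, `s ≥ η_ε(L)`, `t = √(r² + s²)` and `λ ∈ L`,
`P(λ) = ∫ ρ_r(x)/rⁿ · D_{L,s,x}(λ) dx ∈ [G/(1+ε), G/(1-ε)]` with `G = ρ_t(λ) vol(L)/tⁿ`, provided
`ε < 1`. Indeed `D_{L,s,x}(λ) = ρ_s(λ - x)/ρ_s(L - x)` with `ρ_s(L - x) ∈ [1±ε] sⁿ/vol` for all `x`
(Claim 3.8), and `∫ ρ_r(x) ρ_s(λ - x) dx = ρ_t(λ) (rs/t)ⁿ` (product identity and `∫ ρ_σ = σⁿ`).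
[cite: Peikert2010, Thm 3.1 (proof)] -/
theorem Peikert2010.integral_mul_discreteGaussian_mem_Icc {ε r s : ℝ} (hε : 0 < ε) (hε1 : ε < 1)
    (hr : 0 < r) (hs : 0 < s) (hη : smoothingParameter L ε ≤ s) (lam : L) :
    gaussianFunction (Real.sqrt (r ^ 2 + s ^ 2)) (lam : E) * ZLattice.covolume L /
          Real.sqrt (r ^ 2 + s ^ 2) ^ finrank ℝ E / (1 + ε) ≤
        ∫ x : E, gaussianFunction r x / r ^ finrank ℝ E * (discreteGaussian L s x lam).toReal ∧
      ∫ x : E, gaussianFunction r x / r ^ finrank ℝ E * (discreteGaussian L s x lam).toReal ≤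
        gaussianFunction (Real.sqrt (r ^ 2 + s ^ 2)) (lam : E) * ZLattice.covolume L /
          Real.sqrt (r ^ 2 + s ^ 2) ^ finrank ℝ E / (1 - ε) := by
  set n : ℕ := finrank ℝ E with hn
  set t := Real.sqrt (r ^ 2 + s ^ 2) with ht
  have ht0 : 0 < t := Real.sqrt_pos.2 (by positivity)
  set σ := r * s / t with hσdef
  have hσ0 : 0 < σ := by positivity
  have hcov : 0 < ZLattice.covolume L := ZLattice.covolume_pos L volume
  have h1e : 0 < 1 - ε := by linarith
  have h2e : 0 < 1 + ε := by linarith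
  set Ks : ℝ := s ^ n / ZLattice.covolume L with hKs
  have hKs0 : 0 < Ks := div_pos (pow_pos hs n) hcov
  have hrn0 : 0 < r ^ n := pow_pos hr n
  -- the integrand `f` and the explicit Gaussian product `h`
  set f : E → ℝ := fun x => gaussianFunction r x / r ^ n * (discreteGaussian L s x lam).toReal with hf
  set h : E → ℝ := fun x => gaussianFunction r x * gaussianFunction s ((lam : E) - x) with hh
  have hh_nonneg : ∀ x, 0 ≤ h x := fun x =>
    mul_nonneg (gaussianFunction_pos _ _).le (gaussianFunction_pos _ _).le
  have hf_eq : ∀ x, f x = h x / (r ^ n * ∑' y : L, gaussianFunction s ((y : E) - x)) := by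
    intro x
    have hM : 0 < ∑' y : L, gaussianFunction s ((y : E) - x) := tsum_gaussianFunction_sub_pos L hs.ne' x
    simp only [hf, hh, toReal_discreteGaussian_apply_eq_div L hs x lam]
    rw [div_mul_div_comm]
  have hf_lo : ∀ x, h x / (r ^ n * ((1 + ε) * Ks)) ≤ f x := by
    intro x
    rw [hf_eq]
    have hM0 : 0 < ∑' y : L, gaussianFunction s ((y : E) - x) := tsum_gaussianFunction_sub_pos L hs.ne' x
    exact div_le_div_of_nonneg_left (hh_nonneg x) (mul_pos hrn0 hM0)
      (mul_le_mul_of_nonneg_left (tsum_gaussianFunction_sub_mem_Icc L hε hs hη x).2 hrn0.le)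
  have hf_hi : ∀ x, f x ≤ h x / (r ^ n * ((1 - ε) * Ks)) := by
    intro x
    rw [hf_eq]
    exact div_le_div_of_nonneg_left (hh_nonneg x) (mul_pos hrn0 (mul_pos h1e hKs0))
      (mul_le_mul_of_nonneg_left (tsum_gaussianFunction_sub_mem_Icc L hε hs hη x).1 hrn0.le)
  -- `∫ h = ρ_t(λ) σⁿ`
  set c' : E := (r ^ 2 / t ^ 2) • (lam : E) with hc'
  have hh_eq : h = fun x => gaussianFunction t (lam : E) * gaussianFunction σ (x - c') := by
    funext x
    exact gaussianFunction_mul_gaussianFunction_sub' hr hs x (lam : E)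
  have hh_int : Integrable h := by
    rw [hh_eq]
    exact (integrable_gaussianFunction_sub hσ0 c').const_mul _
  have hh_val : ∫ x, h x = gaussianFunction t (lam : E) * σ ^ n := by
    rw [hh_eq, integral_const_mul, integral_gaussianFunction_sub hσ0 c']
  -- integrability of `f` (measurable, dominated by a multiple of `h`)
  have hf_meas : Measurable f := by
    refine Measurable.mul (Continuous.measurable ?_) (measurable_toReal_discreteGaussian_apply L hs lam)
    unfold gaussianFunction; fun_prop
  have hf_nonneg : ∀ x, 0 ≤ f x := fun x =>
    mul_nonneg (div_nonneg (gaussianFunction_pos _ _).le hrn0.le) ENNReal.toReal_nonneg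
  have hf_int : Integrable f := by
    refine Integrable.mono' (hh_int.div_const (r ^ n * ((1 - ε) * Ks))) hf_meas.aestronglyMeasurable
      (Filter.Eventually.of_forall fun x => ?_)
    rw [Real.norm_eq_abs, abs_of_nonneg (hf_nonneg x)]
    exact hf_hi x
  -- the value of the two bounding integrals
  have hσn : σ ^ n = r ^ n * s ^ n / t ^ n := by rw [hσdef, div_pow, mul_pow]
  have hval : ∀ {a : ℝ}, 0 < a → ∫ x, h x / (r ^ n * (a * Ks)) =
      gaussianFunction t (lam : E) * ZLattice.covolume L / t ^ n / a := by
    intro a ha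
    rw [integral_div, hh_val, hσn, hKs]
    have hrn : r ^ n ≠ 0 := pow_ne_zero _ hr.ne'
    have hsn : s ^ n ≠ 0 := pow_ne_zero _ hs.ne'
    have htn : t ^ n ≠ 0 := pow_ne_zero _ ht0.ne'
    have hcv : ZLattice.covolume L ≠ 0 := hcov.ne'
    have han : a ≠ 0 := ha.ne'
    field_simp
  constructor
  · rw [← hval h2e]
    exact integral_mono (hh_int.div_const _) hf_int hf_lo
  · rw [← hval h1e]
    exact integral_mono hf_int (hh_int.div_const _) hf_hi

/-- The target discrete Gaussian is squeezed too: for `0 < ε < 1`, `t ≥ η_ε(L)` (`0 < t`) and `λ ∈ L`,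
`D_{L,t}(λ) = ρ_t(λ)/ρ_t(L) ∈ [G/(1+ε), G/(1-ε)]`, `G = ρ_t(λ) vol(L)/tⁿ` (Claim 3.8 for `ρ_t(L)`).
[cite: RegevLWE2009, Claim 3.8] -/
theorem Peikert2010.toReal_discreteGaussian_mem_Icc {ε t : ℝ} (hε : 0 < ε) (hε1 : ε < 1)
    (ht0 : 0 < t) (hηt : smoothingParameter L ε ≤ t) (lam : L) :
    gaussianFunction t (lam : E) * ZLattice.covolume L / t ^ finrank ℝ E / (1 + ε) ≤
        (discreteGaussian L t 0 lam).toReal ∧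
      (discreteGaussian L t 0 lam).toReal ≤
        gaussianFunction t (lam : E) * ZLattice.covolume L / t ^ finrank ℝ E / (1 - ε) := by
  set n : ℕ := finrank ℝ E with hn
  have hcov : 0 < ZLattice.covolume L := ZLattice.covolume_pos L volume
  have h1e : 0 < 1 - ε := by linarith
  have h2e : 0 < 1 + ε := by linarith
  obtain ⟨hMt1, hMt2⟩ := tsum_gaussianFunction_sub_mem_Icc L hε ht0 hηt (0 : E)
  have hMt0 : 0 < ∑' y : L, gaussianFunction t ((y : E) - 0) := tsum_gaussianFunction_sub_pos L ht0.ne' 0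
  have hKt0 : 0 < t ^ n / ZLattice.covolume L := div_pos (pow_pos ht0 n) hcov
  have htn : t ^ n ≠ 0 := pow_ne_zero _ ht0.ne'
  have hcv : ZLattice.covolume L ≠ 0 := hcov.ne'
  rw [toReal_discreteGaussian_apply_eq_div L ht0 0 lam, sub_zero]
  have hne1 : (1 + ε) ≠ 0 := h2e.ne'
  have hne2 : (1 - ε) ≠ 0 := h1e.ne'
  constructor
  · have hA : gaussianFunction t (lam : E) * ZLattice.covolume L / t ^ n / (1 + ε) =
        gaussianFunction t (lam : E) / ((1 + ε) * (t ^ n / ZLattice.covolume L)) := by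
      field_simp
    have hB : gaussianFunction t (lam : E) / ((1 + ε) * (t ^ n / ZLattice.covolume L)) ≤
        gaussianFunction t (lam : E) / ∑' y : L, gaussianFunction t ((y : E) - 0) :=
      div_le_div_of_nonneg_left (gaussianFunction_pos _ _).le hMt0 hMt2
    exact hA.trans_le hB
  · have hA : gaussianFunction t (lam : E) / ∑' y : L, gaussianFunction t ((y : E) - 0) ≤
        gaussianFunction t (lam : E) / ((1 - ε) * (t ^ n / ZLattice.covolume L)) :=
      div_le_div_of_nonneg_left (gaussianFunction_pos _ _).le (mul_pos h1e hKt0) hMt1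
    have hB : gaussianFunction t (lam : E) / ((1 - ε) * (t ^ n / ZLattice.covolume L)) =
        gaussianFunction t (lam : E) * ZLattice.covolume L / t ^ n / (1 - ε) := by
      field_simp
    exact hA.trans_eq hB

/-- **Peikert 2010, Thm 3.1 (special case; BLPRS 2013, Lemma 2.10), pointwise form.** Let `L` be a
full-rank lattice in dimension `n`, `0 < r, s`, `t = √(r² + s²)`, and `s ≥ η_ε(L)` for some
`0 < ε ≤ 1/2`. Choose `x ← D_r` and then `y ← D_{L-x,s}`; the lattice point `x + y = λ` has
probability `P(λ) = ∫ ρ_r(x)/rⁿ · D_{L,s,x}(λ) dx`, and `|P(λ) - D_{L,t}(λ)| ≤ 4ε · D_{L,t}(λ)` for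
every `λ ∈ L` (both quantities lie in `ρ_t(λ) vol/tⁿ · [1/(1+ε), 1/(1-ε)]`).
[cite: Peikert2010, Thm 3.1] -/
theorem Peikert2010.abs_integral_mul_discreteGaussian_sub_le {ε r s : ℝ} (hε : 0 < ε)
    (hε' : ε ≤ 1 / 2) (hr : 0 < r) (hs : 0 < s) (hη : smoothingParameter L ε ≤ s) (lam : L) :
    |(∫ x : E, gaussianFunction r x / r ^ finrank ℝ E * (discreteGaussian L s x lam).toReal) -
        (discreteGaussian L (Real.sqrt (r ^ 2 + s ^ 2)) 0 lam).toReal| ≤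
      4 * ε * (discreteGaussian L (Real.sqrt (r ^ 2 + s ^ 2)) 0 lam).toReal := by
  have hε1 : ε < 1 := by linarith
  have ht0 : 0 < Real.sqrt (r ^ 2 + s ^ 2) := Real.sqrt_pos.2 (by positivity)
  have hst : s ≤ Real.sqrt (r ^ 2 + s ^ 2) := by
    rw [Real.le_sqrt hs.le] <;> nlinarith [sq_nonneg r, sq_nonneg s]
  have hηt : smoothingParameter L ε ≤ Real.sqrt (r ^ 2 + s ^ 2) := hη.trans hst
  obtain ⟨hI1, hI2⟩ := Peikert2010.integral_mul_discreteGaussian_mem_Icc L hε hε1 hr hs hη lam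
  obtain ⟨hD1, hD2⟩ := Peikert2010.toReal_discreteGaussian_mem_Icc L hε hε1 ht0 hηt lam
  have hG0 : 0 ≤ gaussianFunction (Real.sqrt (r ^ 2 + s ^ 2)) (lam : E) * ZLattice.covolume L /
      Real.sqrt (r ^ 2 + s ^ 2) ^ finrank ℝ E :=
    div_nonneg (mul_nonneg (gaussianFunction_pos _ _).le (ZLattice.covolume_pos L volume).le)
      (pow_nonneg ht0.le _)
  exact abs_sub_le_four_mul_of_div_le hε hε' hG0 hI1 hI2 hD1 hD2

/-- **Peikert 2010, Thm 3.1 (special case; BLPRS 2013, Lemma 2.10), summed form**: under the same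
hypotheses, `∑_{λ ∈ L} |P(λ) - D_{L,t}(λ)| ≤ 4ε` (sum the pointwise bound against the probability mass
function `D_{L,t}`). [cite: Peikert2010, Thm 3.1] -/
theorem Peikert2010.tsum_abs_integral_mul_discreteGaussian_sub_le {ε r s : ℝ} (hε : 0 < ε)
    (hε' : ε ≤ 1 / 2) (hr : 0 < r) (hs : 0 < s) (hη : smoothingParameter L ε ≤ s) :
    ∑' lam : L, |(∫ x : E, gaussianFunction r x / r ^ finrank ℝ E * (discreteGaussian L s x lam).toReal) -
        (discreteGaussian L (Real.sqrt (r ^ 2 + s ^ 2)) 0 lam).toReal| ≤ 4 * ε := by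
  set t := Real.sqrt (r ^ 2 + s ^ 2) with ht
  set D : L → ℝ := fun lam => (discreteGaussian L t 0 lam).toReal with hD
  have hpt : ∀ lam, |(∫ x : E, gaussianFunction r x / r ^ finrank ℝ E *
      (discreteGaussian L s x lam).toReal) - D lam| ≤ 4 * ε * D lam := fun lam =>
    Peikert2010.abs_integral_mul_discreteGaussian_sub_le L hε hε' hr hs hη lam
  have hne : ∀ lam, discreteGaussian L t 0 lam ≠ ∞ := fun lam => PMF.apply_ne_top _ _
  have hcoe : ∑' lam, discreteGaussian L t 0 lam = 1 := (discreteGaussian L t 0).tsum_coe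
  have hDs : Summable D := ENNReal.summable_toReal (by rw [hcoe]; exact ENNReal.one_ne_top)
  have hDv : ∑' lam, D lam = 1 := by
    simp only [hD]
    rw [← ENNReal.tsum_toReal_eq hne, hcoe, ENNReal.toReal_one]
  have hbd : Summable fun lam => 4 * ε * D lam := hDs.mul_left _
  have habs : Summable fun lam => |(∫ x : E, gaussianFunction r x / r ^ finrank ℝ E *
      (discreteGaussian L s x lam).toReal) - D lam| :=
    Summable.of_nonneg_of_le (fun _ => abs_nonneg _) hpt hbd
  calc _ ≤ ∑' lam, 4 * ε * D lam := Summable.tsum_le_tsum hpt habs hbd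
    _ = 4 * ε * ∑' lam, D lam := tsum_mul_left
    _ = 4 * ε := by rw [hDv, mul_one]

/-- **BLPRS 2013, Lemma 2.10, as printed** (special case of Peikert 2010, Thm 3.1): for a full-rank
lattice `L`, `0 < r, s` with `s ≥ η_ε(L)` for some `0 < ε ≤ 1/2`, if `x ← D_r` and then
`y ← D_{L-x,s}`, then `x + y` is within statistical distance `8ε` of `D_{L,√(r²+s²)}`: the statistical
distance `½ ∑_λ |P(λ) - D_{L,t}(λ)|` of the two mass functions on `L` is `≤ 8ε` (indeed `≤ 2ε`, by
`Peikert2010.tsum_abs_integral_mul_discreteGaussian_sub_le`). [cite: BrakerskiEtAl2013, Lemma 2.10] -/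
theorem Peikert2010.half_tsum_abs_sub_le {ε r s : ℝ} (hε : 0 < ε) (hε' : ε ≤ 1 / 2) (hr : 0 < r)
    (hs : 0 < s) (hη : smoothingParameter L ε ≤ s) :
    2⁻¹ * ∑' lam : L, |(∫ x : E, gaussianFunction r x / r ^ finrank ℝ E *
          (discreteGaussian L s x lam).toReal) -
        (discreteGaussian L (Real.sqrt (r ^ 2 + s ^ 2)) 0 lam).toReal| ≤ 8 * ε := by
  have h := Peikert2010.tsum_abs_integral_mul_discreteGaussian_sub_le L hε hε' hr hs hη
  nlinarith [h, hε]

end Literature.Algebra.EuclideanLattices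

end
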